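import Summits.HodgeConjecture.HodgeConjecture.Theorems.F0P3cStCharTSHCDCoordinates   -- ★ (CO) FILE 1 (this seat): §0 left inverse, §1 `lie_eq_iff` + pair∕skew algebra
import Literature.LinearAlgebra.Matrix.MinimalNilpotentSliceFinThree                  -- ★ (D) p852027 (F0P3-p02 g22): `commute_single_two_zero_iff` (the centraliser `𝔷(E₂₀)` entrywise), §5 torus weights
import HarnessLib

/-!
# F0 · P3c · line LH6 «StCharTS» — ROAD «HC-D» brick (CO) «REAL-FORM COORDINATES», FILE 2: the SLODOWY-SLICE chart
# `Φ_S : (Fin 4 → F′) ≃ₜ+ ↥(𝔷(E₂₀) ⊓ 𝔲₀)` with its torus weights `(2, 3, 3, 4)`, the CHEVALLEY-TARGET chart `Φ_A : (Fin 2 → F′) ≃ₜ+ ↥A`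
# (`A = {(c, d) | σ c = c, σ d = −d}`), and the cusp discriminant `−4c³ − 27d²` read in `F′`-coordinates

Cell `pub/hodgecm-mathlib`, crux H413 = `stmt-HodgeConjecture-24833` (lane `--supports … --as helper`), route HCCMUnconditional; seat F0P2-p06 (g18), brick (CO) of
the road «HC-D» of F0P2-p01 (g23) (deal: bus F0∕P2 2026-09-02T16:29:10Z «R3♭ (3)»).  THEOREMS ONLY (no definition ∕ instance ∕ notation ∕ named fact ∕ `sorry`);
Mathlib + ★ FILE 1 `…HCDCoordinates` + ★ (D) `Literature/LinearAlgebra/Matrix/MinimalNilpotentSliceFinThree`.  Frame and letters = FILE 1's (`σ hσ`, `2 ∈ Kˣ`,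
`J = !![0,0,1;0,1,0;1,0,0]`, closed embedding `ι : F′ →+* K` onto the fixed field, skew unit `lam`).

* §1 **`exists_coords_slice`** — for an ARBITRARY additive subgroup `C ≤ M₃(K)` with `hC : X ∈ C ↔ ((X.map σ)ᵀ * J + J * X = 0 ∧ trace X = 0) ∧ X * E₂₀ = E₂₀ * X`
  (`E₂₀ = single 2 0 1`; i.e. `C = 𝔷(N⁻) ⊓ 𝔲₀` for the opposite nilpotent `N⁻ = E₂₀` of the model slice, ★ (D) §2): an explicit `Φ_S : (Fin 4 → F′) ≃ₜ+ ↥C` with entries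
  `X₀₀ = X₂₂ = lam·ι c₀`, `X₁₁ = −2·lam·ι c₀`, `X₁₀ = ι c₁ + lam·ι c₂`, `X₂₁ = −ι c₁ + lam·ι c₂`, `X₂₀ = lam·ι c₃`, `X₀₁ = X₀₂ = X₁₂ = 0`; scaling equivariance; and the
  WEIGHTS of the contracting torus `ρ_t Z = t²·(diag(t⁻¹,1,t) Z diag(t,1,t⁻¹))` (★ (D) §5) at `t = ι s`, `s ∈ F′ˣ`: `ρ_{ι s} (Φ_S c) = Φ_S (s²c₀, s³c₁, s³c₂, s⁴c₃)`.
* §2 **`exists_coords_chevalleyTarget`** — for an ARBITRARY additive subgroup `A ≤ K × K` with `hA : p ∈ A ↔ σ p.1 = p.1 ∧ σ p.2 = −p.2`: an explicit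
  `Φ_A : (Fin 2 → F′) ≃ₜ+ ↥A`, `Φ_A a = (ι a₀, lam·ι a₁)`, with scaling equivariance.
* §3 `exists_sq_eq_and_cusp_discr` — `lam² = ι m` for some `m : F′`, and `−4(ι a)³ − 27(lam·ι b)² = ι (−4a³ − 27·m·b²)` (the cusp discriminant in coordinates).
Consumers: D5(iii) (slice chart + (D3v) vertex engine with weights `(2,3,3,4)`), D5(i) ∕ D3c docking (F0P3-p04, F0P3b-p01: `Φ_A`, `δ`).
HONEST LABEL: HC_CM is proved only modulo the 7 printed citations (2 remaining named inputs: hLiu418 = `stmt-HodgeConjecture-24832`, h413 = `stmt-HodgeConjecture-24833`)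
until rung 0 closes; this file closes no organ (count-neutral plumbing for the (HC-D) named input `hDGliO` of ★ RUNG0).

## References
* [Rogawski1990] J. D. Rogawski, *Automorphic Representations of Unitary Groups in Three Variables*, Ann. of Math. Stud. 123 (1990), §4.9 p. 54, §12.5 p. 182.
* [PlatonovRapinchuk1994] V. Platonov, A. Rapinchuk, *Algebraic Groups and Number Theory* (1994), §2.3.3 (unitary groups of hermitian forms over quadratic extensions).
* [Humphreys1972] J. E. Humphreys, *Introduction to Lie Algebras and Representation Theory*, GTM 9 (1972), §7.2 (weights of the `𝔰𝔩₂`-triple; context for the slice torus).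
-/

set_option autoImplicit false
-- the mandated namespace has the single-problem summit's repeated segment (`HodgeConjecture.HodgeConjecture`)
set_option linter.dupNamespace false

open Matrix Topology

namespace Summit.HodgeConjecture.HodgeConjecture.Cruxes.H413.F0P3cStCharTSHCDCoordinates

section Slice

variable {K : Type*} [Field K] [TopologicalSpace K] [IsTopologicalRing K]
  (σ : K →+* K) (hσ : ∀ x, σ (σ x) = x) [Invertible (2 : K)]
  {J : Matrix (Fin 3) (Fin 3) K} (hJ : J = !![0, 0, 1; 0, 1, 0; 1, 0, 0])
  {F' : Type*} [Field F'] [TopologicalSpace F']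
  (ι : F' →+* K) (hι : IsClosedEmbedding ι) (hιr : ∀ x, σ x = x ↔ x ∈ Set.range ι)
  (lam : Kˣ) (hlam : σ lam = -lam)

include hσ hJ hι hιr hlam

/-! ## §1 The slice chart `Φ_S : (Fin 4 → F′) ≃ₜ+ ↥(𝔷(E₂₀) ⊓ 𝔲₀)` and its torus weights -/

/-- **The coordinate chart of the slice part `C = 𝔷(E₂₀) ⊓ 𝔲₀`**: an explicit `Φ_S : (Fin 4 → F′) ≃ₜ+ ↥C` with entries `X₀₀ = X₂₂ = lam·ι c₀`, `X₁₁ = −2·lam·ι c₀`,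
`X₁₀ = ι c₁ + lam·ι c₂`, `X₂₁ = −ι c₁ + lam·ι c₂`, `X₂₀ = lam·ι c₃`, `X₀₁ = X₀₂ = X₁₂ = 0`; scaling equivariance `Φ_S (l • c) = ι l • Φ_S c`; and the WEIGHTS
`(2, 3, 3, 4)` of the contracting torus: `(ι s)² • (diag((ι s)⁻¹, 1, ι s) · Φ_S c · diag(ι s, 1, (ι s)⁻¹)) = Φ_S (s²c₀, s³c₁, s³c₂, s⁴c₃)` for `s ≠ 0`.
[cite: Rogawski1990, §4.9 p. 54] [cite: Humphreys1972, §7.2] -/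
theorem exists_coords_slice (C : AddSubgroup (Matrix (Fin 3) (Fin 3) K))
    (hC : ∀ X, X ∈ C ↔ ((X.map σ)ᵀ * J + J * X = 0 ∧ Matrix.trace X = 0) ∧
      X * Matrix.single (2 : Fin 3) (0 : Fin 3) (1 : K) = Matrix.single (2 : Fin 3) (0 : Fin 3) 1 * X) :
    ∃ Φ : (Fin 4 → F') ≃ₜ+ ↥C,
      (∀ c : Fin 4 → F',
        ((Φ c : ↥C) : Matrix (Fin 3) (Fin 3) K) 0 0 = lam * ι (c 0) ∧
        ((Φ c : ↥C) : Matrix (Fin 3) (Fin 3) K) 1 1 = -(2 * (lam * ι (c 0))) ∧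
        ((Φ c : ↥C) : Matrix (Fin 3) (Fin 3) K) 2 2 = lam * ι (c 0) ∧
        ((Φ c : ↥C) : Matrix (Fin 3) (Fin 3) K) 1 0 = ι (c 1) + lam * ι (c 2) ∧
        ((Φ c : ↥C) : Matrix (Fin 3) (Fin 3) K) 2 1 = -ι (c 1) + lam * ι (c 2) ∧
        ((Φ c : ↥C) : Matrix (Fin 3) (Fin 3) K) 2 0 = lam * ι (c 3) ∧
        ((Φ c : ↥C) : Matrix (Fin 3) (Fin 3) K) 0 1 = 0 ∧
        ((Φ c : ↥C) : Matrix (Fin 3) (Fin 3) K) 0 2 = 0 ∧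
        ((Φ c : ↥C) : Matrix (Fin 3) (Fin 3) K) 1 2 = 0) ∧
      (∀ (l : F') (c : Fin 4 → F'), ((Φ (l • c) : ↥C) : Matrix (Fin 3) (Fin 3) K) = ι l • ((Φ c : ↥C) : Matrix (Fin 3) (Fin 3) K)) ∧
      (∀ (s : F') (_ : s ≠ 0) (c : Fin 4 → F'),
        ((ι s) ^ 2) • (Matrix.diagonal ![(ι s)⁻¹, 1, ι s] * ((Φ c : ↥C) : Matrix (Fin 3) (Fin 3) K) * Matrix.diagonal ![ι s, 1, (ι s)⁻¹]) =
          ((Φ ![s ^ 2 * c 0, s ^ 3 * c 1, s ^ 3 * c 2, s ^ 4 * c 3] : ↥C) : Matrix (Fin 3) (Fin 3) K)) := by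
  subst hJ
  obtain ⟨g, hg, hgc⟩ := exists_continuousOn_leftInverse ι hι
  have hισ : ∀ a, σ (ι a) = ι a := fun a => (hιr _).2 ⟨a, rfl⟩
  have hfix : ∀ x : K, σ x = x → ι (g x) = x := fun x hx => by
    obtain ⟨a, rfl⟩ := (hιr x).1 hx; rw [hg]
  have hιc : Continuous ι := hι.continuous
  have h22 : (2 : K) * ⅟(2 : K) = 1 := mul_invOf_self 2
  -- the forward matrix
  set M : (Fin 4 → F') → Matrix (Fin 3) (Fin 3) K := fun c =>
    !![lam * ι (c 0), 0, 0;
       ι (c 1) + lam * ι (c 2), -(2 * (lam * ι (c 0))), 0;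
       lam * ι (c 3), -ι (c 1) + lam * ι (c 2), lam * ι (c 0)] with hM
  have hMmem : ∀ c, M c ∈ C := fun c => by
    rw [hC, lie_eq_iff, Matrix.trace_fin_three, Literature.LinearAlgebra.Matrix.commute_single_two_zero_iff]
    simp only [hM, Matrix.of_apply, Matrix.cons_val', Matrix.cons_val_zero, Matrix.cons_val_one, Matrix.cons_val_two, Matrix.head_cons,
      Matrix.tail_cons, Matrix.empty_val', Matrix.cons_val_fin_one, Matrix.head_fin_const, map_add, map_neg, map_mul, map_ofNat, map_zero, hισ, hlam]
    refine ⟨⟨⟨⟨by ring, by ring, by ring⟩, ⟨by ring, by ring, by ring⟩, ⟨by ring, by ring, by ring⟩⟩, by ring⟩, ⟨trivial, trivial, trivial, trivial⟩⟩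
  -- the backward coordinates
  set N : Matrix (Fin 3) (Fin 3) K → (Fin 4 → F') := fun X =>
    ![g (X 0 0 * ((lam⁻¹ : Kˣ) : K)), g ((X 1 0 - X 2 1) * ⅟(2 : K)), g ((X 1 0 + X 2 1) * ⅟(2 : K) * ((lam⁻¹ : Kˣ) : K)),
      g (X 2 0 * ((lam⁻¹ : Kˣ) : K))] with hN
  -- left inverse
  have hNM : ∀ c, N (M c) = c := fun c => by
    funext k
    fin_cases k <;>
      simp only [hN, hM, Matrix.of_apply, Matrix.cons_val', Matrix.cons_val_zero, Matrix.cons_val_one, Matrix.cons_val_two, Matrix.head_cons,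
        Matrix.tail_cons, Matrix.empty_val', Matrix.cons_val_fin_one, Matrix.head_fin_const, Fin.isValue, Fin.mk_zero, Fin.mk_one, Fin.reduceFinMk,
        Matrix.cons_val, pair_fst, pair_snd, skew_coord, hg]
  -- right inverse on `C`
  have hMN : ∀ X ∈ C, M (N X) = X := fun X hX => by
    rw [hC, lie_eq_iff, Matrix.trace_fin_three, Literature.LinearAlgebra.Matrix.commute_single_two_zero_iff] at hX
    obtain ⟨⟨⟨⟨h00, h01, h02⟩, ⟨h10, h11, h12⟩, ⟨h20, h21, h22'⟩⟩, htr⟩, ⟨hz01, hz02, hz12, hdd⟩⟩ := hX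
    have hsk0 : σ (X 0 0) + X 0 0 = 0 := by rw [hdd] at h02 ⊢; exact h02
    have f0 := hfix _ (skew_fixed σ lam hlam hsk0)
    have f1 := hfix _ (pair_fst_fixed σ hσ h01)
    have f2 := hfix _ (pair_snd_fixed σ hσ lam hlam h01)
    have f3 := hfix _ (skew_fixed σ lam hlam h00)
    ext i j
    fin_cases i <;> fin_cases j <;>
      simp only [hM, hN, Matrix.of_apply, Matrix.cons_val', Matrix.cons_val_zero, Matrix.cons_val_one, Matrix.cons_val_two, Matrix.head_cons,
        Matrix.tail_cons, Matrix.empty_val', Matrix.cons_val_fin_one, Matrix.head_fin_const, Fin.isValue, Fin.mk_zero, Fin.mk_one, Fin.reduceFinMk,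
        Matrix.cons_val, f0, f1, f2, f3] <;>
      first
        | exact skew_recombine lam _
        | exact pair_recombine_fst lam _ _
        | exact pair_recombine_snd lam _ _
        | exact hz01.symm
        | exact hz02.symm
        | exact hz12.symm
        | (rw [skew_recombine]; exact hdd)
        | (rw [skew_recombine]; linear_combination (-1 : K) * htr - (1 : K) * hdd)
  -- continuity
  have hMc : Continuous M := by
    refine continuous_matrix fun i j => ?_
    fin_cases i <;> fin_cases j <;>
      simp only [hM, Matrix.of_apply, Matrix.cons_val', Matrix.cons_val_zero, Matrix.cons_val_one, Matrix.cons_val_two, Matrix.head_cons,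
        Matrix.tail_cons, Matrix.empty_val', Matrix.cons_val_fin_one, Matrix.head_fin_const, Fin.isValue, Fin.mk_zero, Fin.mk_one, Fin.reduceFinMk] <;>
      fun_prop
  have hNc : Continuous fun X : ↥C => N (X : Matrix (Fin 3) (Fin 3) K) := by
    refine continuous_pi fun k => ?_
    have hent : ∀ i j, Continuous fun X : ↥C => (X : Matrix (Fin 3) (Fin 3) K) i j :=
      fun i j => (continuous_apply j).comp ((continuous_apply i).comp continuous_subtype_val)
    have hmem : ∀ X : ↥C, ((((X : Matrix (Fin 3) (Fin 3) K).map σ)ᵀ * !![(0 : K), 0, 1; 0, 1, 0; 1, 0, 0] +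
        !![(0 : K), 0, 1; 0, 1, 0; 1, 0, 0] * (X : Matrix (Fin 3) (Fin 3) K) = 0) ∧
        (X : Matrix (Fin 3) (Fin 3) K) 0 0 = (X : Matrix (Fin 3) (Fin 3) K) 2 2) := fun X =>
      ⟨((hC _).1 X.2).1.1, ((Literature.LinearAlgebra.Matrix.commute_single_two_zero_iff _).1 ((hC _).1 X.2).2).2.2.2⟩
    have hsk : ∀ X : ↥C, σ ((X : Matrix (Fin 3) (Fin 3) K) 0 0) + (X : Matrix (Fin 3) (Fin 3) K) 0 0 = 0 := fun X => by
      have h := ((lie_eq_iff σ _).1 (hmem X).1).1.2.2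
      rw [(hmem X).2] at h ⊢; exact h
    fin_cases k <;>
      simp only [hN, Matrix.cons_val_zero, Matrix.cons_val_one, Matrix.cons_val_two, Matrix.head_cons, Matrix.tail_cons,
        Fin.isValue, Fin.mk_zero, Fin.mk_one, Fin.reduceFinMk, Matrix.cons_val]
    · exact hgc.comp_continuous ((hent 0 0).mul continuous_const) fun X => (hιr _).1 (skew_fixed σ lam hlam (hsk X))
    · exact hgc.comp_continuous ((hent 1 0).sub (hent 2 1) |>.mul continuous_const) fun X =>
        (hιr _).1 (pair_fst_fixed σ hσ ((lie_eq_iff σ _).1 (hmem X).1).1.2.1)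
    · exact hgc.comp_continuous (((hent 1 0).add (hent 2 1) |>.mul continuous_const).mul continuous_const) fun X =>
        (hιr _).1 (pair_snd_fixed σ hσ lam hlam ((lie_eq_iff σ _).1 (hmem X).1).1.2.1)
    · exact hgc.comp_continuous ((hent 2 0).mul continuous_const) fun X =>
        (hιr _).1 (skew_fixed σ lam hlam ((lie_eq_iff σ _).1 (hmem X).1).1.1)
  -- additivity
  have hMadd : ∀ a b, M (a + b) = M a + M b := fun a b => by
    ext i j
    fin_cases i <;> fin_cases j <;>
      simp only [hM, Matrix.add_apply, Pi.add_apply, Matrix.of_apply, Matrix.cons_val', Matrix.cons_val_zero, Matrix.cons_val_one, Matrix.cons_val_two,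
        Matrix.head_cons, Matrix.tail_cons, Matrix.empty_val', Matrix.cons_val_fin_one, Matrix.head_fin_const, Fin.isValue, Fin.mk_zero, Fin.mk_one,
        Fin.reduceFinMk, map_add] <;> ring
  -- assemble
  let Φ : (Fin 4 → F') ≃ₜ+ ↥C :=
    { toFun := fun c => ⟨M c, hMmem c⟩
      invFun := fun X => N (X : Matrix (Fin 3) (Fin 3) K)
      left_inv := fun c => hNM c
      right_inv := fun X => Subtype.ext (hMN X.1 X.2)
      map_add' := fun a b => Subtype.ext (hMadd a b)
      continuous_toFun := hMc.subtype_mk _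
      continuous_invFun := hNc }
  have hΦ : ∀ c, ((Φ c : ↥C) : Matrix (Fin 3) (Fin 3) K) = M c := fun c => rfl
  refine ⟨Φ, fun c => ?_, fun l c => ?_, fun s hs c => ?_⟩
  · simp only [hΦ, hM, Matrix.of_apply, Matrix.cons_val', Matrix.cons_val_zero, Matrix.cons_val_one, Matrix.cons_val_two, Matrix.head_cons,
      Matrix.tail_cons, Matrix.empty_val', Matrix.cons_val_fin_one, Matrix.head_fin_const, and_self]
  · rw [hΦ, hΦ]
    ext i j
    fin_cases i <;> fin_cases j <;>
      simp only [hM, Matrix.smul_apply, Pi.smul_apply, smul_eq_mul, Matrix.of_apply, Matrix.cons_val', Matrix.cons_val_zero, Matrix.cons_val_one,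
        Matrix.cons_val_two, Matrix.head_cons, Matrix.tail_cons, Matrix.empty_val', Matrix.cons_val_fin_one, Matrix.head_fin_const, Fin.isValue,
        Fin.mk_zero, Fin.mk_one, Fin.reduceFinMk, map_mul, mul_zero] <;> ring
  · rw [hΦ, hΦ]
    have hs' : ι s ≠ 0 := (map_ne_zero ι).2 hs
    have hinv : (ι s)⁻¹ * ι s = 1 := inv_mul_cancel₀ hs'
    ext i j
    fin_cases i <;> fin_cases j <;>
      simp only [hM, Matrix.smul_apply, smul_eq_mul, Matrix.mul_apply, Matrix.diagonal, Matrix.of_apply, Fin.sum_univ_three, Matrix.cons_val',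
        Matrix.cons_val_zero, Matrix.cons_val_one, Matrix.cons_val_two, Matrix.head_cons, Matrix.tail_cons, Matrix.empty_val', Matrix.cons_val_fin_one,
        Matrix.head_fin_const, Fin.isValue, Fin.mk_zero, Fin.mk_one, Fin.reduceFinMk, Matrix.cons_val, map_mul, map_pow] <;>
      simp <;> first | ring1 | linear_combination (ι s ^ 2 * (lam : K) * ι (c 0)) * hinv

/-! ## §2 The Chevalley-target chart `Φ_A : (Fin 2 → F′) ≃ₜ+ ↥A`, `A = {(c, d) | σ c = c, σ d = −d}` -/

omit hσ hJ [Invertible (2 : K)] in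
/-- **The coordinate chart of the Chevalley target** `A = {(c, d) ∈ K × K | σ c = c, σ d = −d}` (an ARBITRARY additive subgroup with that membership): an explicit
`Φ_A : (Fin 2 → F′) ≃ₜ+ ↥A`, `Φ_A a = (ι a₀, lam·ι a₁)`, with the scaling equivariance `Φ_A (l • a) = (ι l · _, ι l · _)`. [cite: Rogawski1990, §4.9 p. 54]
[cite: PlatonovRapinchuk1994, §2.3.3] -/
theorem exists_coords_chevalleyTarget (A : AddSubgroup (K × K)) (hA : ∀ p : K × K, p ∈ A ↔ σ p.1 = p.1 ∧ σ p.2 = -p.2) :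
    ∃ Φ : (Fin 2 → F') ≃ₜ+ ↥A,
      (∀ a : Fin 2 → F', ((Φ a : ↥A) : K × K) = (ι (a 0), lam * ι (a 1))) ∧
      (∀ (l : F') (a : Fin 2 → F'), ((Φ (l • a) : ↥A) : K × K) = (ι l * ((Φ a : ↥A) : K × K).1, ι l * ((Φ a : ↥A) : K × K).2)) := by
  obtain ⟨g, hg, hgc⟩ := exists_continuousOn_leftInverse ι hι
  have hισ : ∀ a, σ (ι a) = ι a := fun a => (hιr _).2 ⟨a, rfl⟩
  have hfix : ∀ x : K, σ x = x → ι (g x) = x := fun x hx => by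
    obtain ⟨a, rfl⟩ := (hιr x).1 hx; rw [hg]
  have hιc : Continuous ι := hι.continuous
  have hmem : ∀ a : Fin 2 → F', (ι (a 0), (lam : K) * ι (a 1)) ∈ A := fun a => by
    rw [hA]; exact ⟨hισ _, by rw [map_mul, hlam, hισ]; ring⟩
  have hskew : ∀ p : ↥A, σ ((p : K × K).2) + (p : K × K).2 = 0 := fun p => by
    have h := ((hA _).1 p.2).2; rw [h]; ring
  let Φ : (Fin 2 → F') ≃ₜ+ ↥A :=
    { toFun := fun a => ⟨(ι (a 0), (lam : K) * ι (a 1)), hmem a⟩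
      invFun := fun p => ![g (p : K × K).1, g ((p : K × K).2 * ((lam⁻¹ : Kˣ) : K))]
      left_inv := fun a => by
        funext k
        fin_cases k
        · simp [hg]
        · simp only [Fin.mk_one, Fin.isValue, Matrix.cons_val_one, Matrix.cons_val_fin_one]
          rw [mul_comm (lam : K), Units.mul_inv_cancel_right, hg]
      right_inv := fun p => by
        apply Subtype.ext
        have h1 : ι (g (p : K × K).1) = (p : K × K).1 := hfix _ ((hA _).1 p.2).1
        have h2 : ι (g ((p : K × K).2 * ((lam⁻¹ : Kˣ) : K))) = (p : K × K).2 * ((lam⁻¹ : Kˣ) : K) := hfix _ (skew_fixed σ lam hlam (hskew p))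
        change (ι (g (p : K × K).1), (lam : K) * ι (g ((p : K × K).2 * ((lam⁻¹ : Kˣ) : K)))) = (p : K × K)
        rw [h1, h2, skew_recombine]
      map_add' := fun a b => Subtype.ext (by
        change (ι ((a + b) 0), (lam : K) * ι ((a + b) 1)) = (ι (a 0), (lam : K) * ι (a 1)) + (ι (b 0), (lam : K) * ι (b 1))
        simp only [Pi.add_apply, map_add, Prod.mk_add_mk, mul_add])
      continuous_toFun := ((hιc.comp (continuous_apply 0)).prodMk (continuous_const.mul (hιc.comp (continuous_apply 1)))).subtype_mk _
      continuous_invFun := by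
        refine continuous_pi fun k => ?_
        fin_cases k
        · simp only [Fin.isValue, Fin.mk_zero, Matrix.cons_val_zero]
          exact hgc.comp_continuous (f := fun p : ↥A => (p : K × K).1) (continuous_fst.comp continuous_subtype_val)
            fun p => (hιr _).1 ((hA _).1 p.2).1
        · simp only [Fin.mk_one, Fin.isValue, Matrix.cons_val_one, Matrix.cons_val_fin_one]
          exact hgc.comp_continuous (f := fun p : ↥A => (p : K × K).2 * ((lam⁻¹ : Kˣ) : K))
            ((continuous_snd.comp continuous_subtype_val).mul continuous_const) fun p => (hιr _).1 (skew_fixed σ lam hlam (hskew p)) }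
  refine ⟨Φ, fun a => rfl, fun l a => ?_⟩
  change (ι ((l • a) 0), (lam : K) * ι ((l • a) 1)) = (ι l * ι (a 0), ι l * ((lam : K) * ι (a 1)))
  simp only [Pi.smul_apply, smul_eq_mul, map_mul]
  refine Prod.ext rfl ?_
  change (lam : K) * (ι l * ι (a 1)) = ι l * ((lam : K) * ι (a 1))
  ring


end Slice

section Cusp

/-! ## §3 The cusp discriminant in coordinates -/

/-- **`lam² ∈ ι F′` and the cusp discriminant in coordinates**: there is `m : F′` with `ι m = lam²`, and for all `a b : F′`,
`−4(ι a)³ − 27(lam·ι b)² = ι (−4a³ − 27·m·b²)` — the plane-cusp discriminant `δ(c, d) = −4c³ − 27d²` of [§1 (i)] read through `Φ_A`.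
[cite: Rogawski1990, §4.9 p. 54] [cite: PlatonovRapinchuk1994, §2.3.3] -/
theorem exists_sq_eq_and_cusp_discr {K : Type*} [Field K] (σ : K →+* K) {F' : Type*} [Field F'] (ι : F' →+* K)
    (hιr : ∀ x, σ x = x ↔ x ∈ Set.range ι) (lam : Kˣ) (hlam : σ lam = -lam) :
    ∃ m : F', ι m = (lam : K) ^ 2 ∧ ∀ a b : F', -4 * ι a ^ 3 - 27 * ((lam : K) * ι b) ^ 2 = ι (-4 * a ^ 3 - 27 * m * b ^ 2) := by
  have hfixsq : σ ((lam : K) ^ 2) = (lam : K) ^ 2 := by rw [map_pow, hlam, neg_sq]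
  obtain ⟨m, hm⟩ := (hιr _).1 hfixsq
  refine ⟨m, hm, fun a b => ?_⟩
  simp only [map_sub, map_mul, map_neg, map_pow, map_ofNat, hm]
  ring

end Cusp

end Summit.HodgeConjecture.HodgeConjecture.Cruxes.H413.F0P3cStCharTSHCDCoordinates
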